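import Literature.MathematicalPhysics.QuantumManyBody.BoseGasThermodynamicLimit
import Literature.MathematicalPhysics.QuantumManyBody.LiebYngvasonCellMethod
import HarnessLib

/-!
# The thermodynamic limit of the Bose gas: finite-volume comparison of boundary conditions

Topic `Literature/MathematicalPhysics/QuantumManyBody`, sibling of `BoseGasThermodynamicLimit.lean`
(provefact `Literature.MathematicalPhysics.QuantumManyBody.BoseGas.LSSY2005_e0_periodic_eq_dirichlet`).
That file vendors, as named facts, the existence of the thermodynamic-limit energy per particle
`e₀(ρ) = lim E₀^D(N, L_N)/N` along the Dirichlet boxes `L_N = (N/ρ)^{1/3}`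
(`LSSY2005_e0_dirichlet_exists`) and its independence of the boundary condition, periodic versus
Dirichlet (`LSSY2005_e0_periodic_eq_dirichlet`) — both ASSERTED, not proved, in the source
[LSSY2005, Ch. 2: after (2.2) "These should not matter for the thermodynamic limit … Dirichlet
boundary conditions … lead … to the highest energies"; after Thm. 2.2 "(and for all boundary
conditions)"; after (2.8)], the rigorous theory being Ruelle 1969 §3.5 / Robinson 1971.

This file PROVES the finite-volume, variational layer of that comparison over the tree's carriers
(`TrialState`/`groundStateEnergy` = `E₀^D` on the open box `(0,L)³`, `PeriodicTrialState`/
`periodicGroundStateEnergy` = `E₀^per` on the torus with the periodised interaction `v^per`):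

* `TrialState.enlarge`, `groundStateEnergy_anti` — a Dirichlet trial state of `Λ_L` is one of
  every larger box, so `E₀^D(N, L') ≤ E₀^D(N, L)` for `L ≤ L'`; along the box sequence,
  `energyPerParticleDirichlet_mono`: `E₀^D(N, L_N(ρ))/N` increases with `ρ` at fixed `N`.
* `periodize L ψ = ψ(· - L⌊·/L⌋)` — the `(Lℤ³)^N`-periodic extension of a wave function from the
  fundamental cell `[0,L)^{3N}`; for `ψ` vanishing off a box `Λ_{L₀}^N`, `L₀ ≤ L`, it is locally a
  FINITE sum of lattice translates (`periodize_eq_sum`), hence `C¹` (`contDiff_periodize`),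
  periodic, and Bose-symmetric when `ψ` is; `TrialState.toPeriodic` is the resulting periodic
  trial state (normalised on the cell, where it is `ψ`).
* `periodizedPotential_eq_of_abs_lt`, `periodicInteraction_eq_interaction_of_mem_boxN` — nearest
  image: for a potential of range `R₀`, on `Λ_{L₀}^N` with `L₀ + R₀ ≤ L` the interaction
  periodised with period `L` is the plain interaction (all images are farther than `R₀`).
* `periodicGroundStateEnergy_le_groundStateEnergy_of_range` — consequently
  **`E₀^per(N, L) ≤ E₀^D(N, L₀)` whenever `L₀ ≤ L` and `L₀ + R₀ ≤ L`**; for the standing class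
  `IsRepulsiveFiniteRange`, `∃ R ≥ 0, E₀^per(N, L₀ + R') ≤ E₀^D(N, L₀)` for all `R' ≥ R`.
* `IsRepulsiveFiniteRange.eventually_energyPerParticlePeriodic_le` — along the box sequences of
  two densities `0 < ρ' < ρ` (whose sides drift apart, `tendsto_sideLength_sub_sideLength`),
  `E₀^per(N, L_N(ρ'))/N ≤ E₀^D(N, L_N(ρ))/N` for all large `N`: the variational half of
  `LSSY2005_e0_periodic_eq_dirichlet`, up to the density shift forced by the padding `R₀`.

## What is NOT here (and why the facts stay facts)

The padding `R₀` (without it the periodised state feels image interactions, and indeed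
`E₀^per(N, L) ≤ E₀^D(N, L)` fails for small boxes) shifts the density, so even the "limsup" half
of the boundary-condition independence needs the continuity of `e₀` in `ρ`, i.e. the
Ruelle–Robinson existence theory of the Dirichlet limit for general box sequences (subadditivity
over separated sub-boxes by symmetrised tensor products, convexity of the energy density); the
"liminf" half needs in addition an IMS localisation of torus states into Dirichlet sub-boxes.
Neither is in the tree yet.

## References

* [LSSY2005] E. H. Lieb, R. Seiringer, J. P. Solovej, J. Yngvason, *The Mathematics of the Bose
  Gas and its Condensation*, Oberwolfach Seminars 34, Birkhäuser 2005 (arXiv:cond-mat/0610117):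
  Ch. 2, (2.1)–(2.2) and the paragraph following (2.2) (p. 9 of the arXiv text), Thm. 2.2 and the
  sentence following it (p. 12), remark after (2.8).
* [Ruelle1969] D. Ruelle, *Statistical Mechanics: Rigorous Results*, Benjamin 1969, §3.5.
* D. W. Robinson, *The Thermodynamic Pressure in Quantum Statistical Mechanics*, LNP 9 (1971).
-/

noncomputable section

open MeasureTheory Filter Metric
open scoped ENNReal NNReal Topology

namespace Literature.MathematicalPhysics.QuantumManyBody.BoseGas

variable {N : ℕ}

/-! ### Monotonicity of the Dirichlet ground-state energy in the box -/

/-- `Λ_L ⊆ Λ_{L'}` for `L ≤ L'` (the boxes share the corner `0`). [folklore] -/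
theorem box_subset_box {L L' : ℝ} (h : L ≤ L') : box L ⊆ box L' :=
  fun _ hx k => ⟨(hx k).1, (hx k).2.trans_le h⟩

/-- `Λ_L^N ⊆ Λ_{L'}^N` for `L ≤ L'`. [folklore] -/
theorem boxN_subset_boxN {L L' : ℝ} (h : L ≤ L') : boxN N L ⊆ boxN N L' :=
  fun _ hX i => box_subset_box h (hX i)

/-- The open box `Λ_{L₀}^N` lies in the fundamental cell `[0,L)^{3N}` of every `L ≥ L₀`. [folklore] -/
theorem boxN_subset_cellN {L₀ L : ℝ} (h : L₀ ≤ L) : boxN N L₀ ⊆ cellN N L :=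
  fun _ hX i k => ⟨(hX i k).1.le, (hX i k).2.trans_le h⟩

/-- A Dirichlet trial state of `Λ_L` is a Dirichlet trial state of every larger box `Λ_{L'}`,
`L ≤ L'` (the same wave function). [folklore] -/
def TrialState.enlarge {L L' : ℝ} (h : L ≤ L') (Ψ : TrialState N L) : TrialState N L' where
  ψ := Ψ.ψ
  contDiff := Ψ.contDiff
  eq_zero X hX := Ψ.eq_zero X fun hX' => hX (boxN_subset_boxN h hX')
  symm := Ψ.symm
  norm_eq := Ψ.norm_eq

/-- Enlarging the box does not change the energy. [folklore] -/
@[simp]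
theorem TrialState.energy_enlarge {L L' : ℝ} (h : L ≤ L') (v : ℝ → ℝ≥0∞) (Ψ : TrialState N L) :
    energy v (Ψ.enlarge h) = energy v Ψ :=
  rfl

/-- **The Dirichlet ground-state energy decreases as the box grows**: `E₀^D(N, L') ≤ E₀^D(N, L)`
for `L ≤ L'` (Dirichlet trial states of the small box are trial states of the large one).
[folklore] -/
theorem groundStateEnergy_anti (v : ℝ → ℝ≥0∞) (N : ℕ) {L L' : ℝ} (h : L ≤ L') :
    groundStateEnergy v N L' ≤ groundStateEnergy v N L :=
  le_iInf fun Ψ => groundStateEnergy_le_energy v (Ψ.enlarge h)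

/-! ### Periodisation of Dirichlet trial states -/

/-- The lattice vector `(L n₁, …, L n_N) ∈ (Lℤ³)^N ⊂ (ℝ³)^N` of `n ∈ (ℤ³)^N`. [folklore] -/
def latticeVecN (L : ℝ) (n : Fin N → Fin 3 → ℤ) : Config N := fun i => latticeVec L (n i)

/-- The cell index `(⌊X_{ik}/L⌋)_{i,k} ∈ (ℤ³)^N` of a configuration: the lattice vector by which
`X` has to be shifted back into the fundamental cell `[0,L)^{3N}`. [folklore] -/
def cellIndex (L : ℝ) (X : Config N) : Fin N → Fin 3 → ℤ := fun i k => ⌊X i k / L⌋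

/-- The `(Lℤ³)^N`-periodic extension `X ↦ ψ(X - L·cellIndex L X)` of (the restriction to the
fundamental cell `[0,L)^{3N}` of) a wave function `ψ`. [folklore] -/
def periodize (L : ℝ) (ψ : Config N → ℂ) (X : Config N) : ℂ :=
  ψ (X - latticeVecN L (cellIndex L X))

/-- Coordinates of a lattice vector: `(Ln)_{ik} = L n_{ik}`. [folklore] -/
@[simp]
theorem latticeVecN_apply (L : ℝ) (n : Fin N → Fin 3 → ℤ) (i : Fin N) (k : Fin 3) :
    latticeVecN L n i k = L * n i k := rfl

/-- `n ↦ Ln` is additive. [folklore] -/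
theorem latticeVecN_add (L : ℝ) (m n : Fin N → Fin 3 → ℤ) :
    latticeVecN L (m + n) = latticeVecN L m + latticeVecN L n := by
  ext i k; simp [mul_add]

/-- `L·0 = 0`. [folklore] -/
@[simp]
theorem latticeVecN_zero (L : ℝ) : latticeVecN L (0 : Fin N → Fin 3 → ℤ) = 0 := by
  ext i k; simp

/-- `X - L·cellIndex L X ∈ [0,L)^{3N}`. [folklore] -/
theorem sub_latticeVecN_cellIndex_mem_cellN {L : ℝ} (hL : 0 < L) (X : Config N) :
    X - latticeVecN L (cellIndex L X) ∈ cellN N L := by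
  intro i k
  have h1 := Int.sub_floor_div_mul_nonneg (X i k) hL
  have h2 := Int.sub_floor_div_mul_lt (X i k) hL
  simp only [Pi.sub_apply, WithLp.ofLp_sub, latticeVecN_apply, Set.mem_Ico]
  have hc : (cellIndex L X i k : ℝ) = ⌊X i k / L⌋ := rfl
  rw [hc]
  constructor <;> linarith [mul_comm L (⌊X i k / L⌋ : ℝ)]

/-- The cell index is the only lattice shift taking `X` into the fundamental cell. [folklore] -/
theorem eq_cellIndex_of_sub_latticeVecN_mem_cellN {L : ℝ} (hL : 0 < L) {X : Config N}
    {n : Fin N → Fin 3 → ℤ} (h : X - latticeVecN L n ∈ cellN N L) : n = cellIndex L X := by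
  funext i k
  have hk := h i k
  simp only [Pi.sub_apply, WithLp.ofLp_sub, latticeVecN_apply, Set.mem_Ico] at hk
  symm
  rw [cellIndex, Int.floor_eq_iff]
  constructor
  · rw [le_div_iff₀ hL]; linarith
  · rw [div_lt_iff₀ hL]; linarith

/-- On the fundamental cell the cell index vanishes. [folklore] -/
theorem cellIndex_eq_zero_of_mem_cellN {L : ℝ} (hL : 0 < L) {X : Config N} (hX : X ∈ cellN N L) :
    cellIndex L X = 0 :=
  (eq_cellIndex_of_sub_latticeVecN_mem_cellN hL (n := 0) (by simpa using hX)).symm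

/-- On the fundamental cell the periodisation is the function itself. [folklore] -/
theorem periodize_of_mem_cellN {L : ℝ} (hL : 0 < L) (ψ : Config N → ℂ) {X : Config N}
    (hX : X ∈ cellN N L) : periodize L ψ X = ψ X := by
  simp [periodize, cellIndex_eq_zero_of_mem_cellN hL hX]

/-- The cell index is equivariant under lattice shifts. [folklore] -/
theorem cellIndex_add_latticeVecN {L : ℝ} (hL : L ≠ 0) (X : Config N) (m : Fin N → Fin 3 → ℤ) :
    cellIndex L (X + latticeVecN L m) = cellIndex L X + m := by
  funext i k
  simp only [cellIndex, PiLp.add_apply, latticeVecN_apply, Pi.add_apply]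
  rw [add_div, mul_div_cancel_left₀ _ hL, Int.floor_add_intCast]

/-- The periodisation is `(Lℤ³)^N`-periodic. [folklore] -/
theorem periodize_add_latticeVecN {L : ℝ} (hL : L ≠ 0) (ψ : Config N → ℂ) (X : Config N)
    (m : Fin N → Fin 3 → ℤ) : periodize L ψ (X + latticeVecN L m) = periodize L ψ X := by
  simp only [periodize, cellIndex_add_latticeVecN hL, latticeVecN_add]
  congr 1
  abel

/-- The generator `L e_{i,k}` of `(Lℤ³)^N` is a lattice vector. [folklore] -/
theorem single_single_eq_latticeVecN (L : ℝ) (i : Fin N) (k : Fin 3) :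
    (Pi.single i (EuclideanSpace.single k L) : Config N) =
      latticeVecN L (Pi.single i (Pi.single k 1)) := by
  ext j m
  by_cases hj : j = i
  · subst hj
    by_cases hm : m = k
    · subst hm; simp
    · simp [hm]
  · simp [hj]

/-- The periodisation is symmetric under the permutations `ψ` is symmetric under. [folklore] -/
theorem periodize_comp_perm {L : ℝ} (ψ : Config N → ℂ) (σ : Equiv.Perm (Fin N))
    (hψ : ∀ X : Config N, ψ (X ∘ σ) = ψ X) (X : Config N) :
    periodize L ψ (X ∘ σ) = periodize L ψ X := by
  have hc : cellIndex L (X ∘ σ) = fun j => cellIndex L X (σ j) := rfl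
  have h : (X ∘ σ) - latticeVecN L (cellIndex L (X ∘ σ)) =
      (X - latticeVecN L (cellIndex L X)) ∘ σ := by
    ext j m
    simp only [hc, Pi.sub_apply, Function.comp_apply, latticeVecN]
  rw [periodize, h, hψ, periodize]

/-- Off the cell index, the lattice translates of a function vanishing off a box
`Λ_{L₀}^N ⊆ [0,L)^{3N}` vanish. [folklore] -/
theorem apply_sub_latticeVecN_eq_zero {L₀ L : ℝ} (hL : 0 < L) (hL₀ : L₀ ≤ L) {ψ : Config N → ℂ}
    (h0 : ∀ X, X ∉ boxN N L₀ → ψ X = 0) {X : Config N} {n : Fin N → Fin 3 → ℤ}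
    (hn : n ≠ cellIndex L X) : ψ (X - latticeVecN L n) = 0 :=
  h0 _ fun hbox => hn (eq_cellIndex_of_sub_latticeVecN_mem_cellN hL (boxN_subset_cellN hL₀ hbox))

/-- The `3^{3N}` lattice indices within one of a given index in every coordinate. [folklore] -/
def nearIndices (c : Fin N → Fin 3 → ℤ) : Finset (Fin N → Fin 3 → ℤ) :=
  Fintype.piFinset fun i => Fintype.piFinset fun k => Finset.Icc (c i k - 1) (c i k + 1)

/-- Membership in `nearIndices`: every coordinate within one. [folklore] -/
theorem mem_nearIndices {c n : Fin N → Fin 3 → ℤ} :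
    n ∈ nearIndices c ↔ ∀ i k, c i k - 1 ≤ n i k ∧ n i k ≤ c i k + 1 := by
  simp [nearIndices, Fintype.mem_piFinset]

/-- Configurations within `L` of `X₀` in every coordinate have cell index near that of `X₀`.
[folklore] -/
theorem cellIndex_mem_nearIndices {L : ℝ} (hL : 0 < L) {X X₀ : Config N}
    (h : ∀ i k, |X i k - X₀ i k| < L) : cellIndex L X ∈ nearIndices (cellIndex L X₀) := by
  rw [mem_nearIndices]
  intro i k
  have hik := h i k
  rw [abs_lt] at hik
  have h1 : X₀ i k / L ≤ X i k / L + 1 := by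
    rw [div_add_one hL.ne', div_le_div_iff_of_pos_right hL]; linarith
  have h2 : X i k / L ≤ X₀ i k / L + 1 := by
    rw [div_add_one hL.ne', div_le_div_iff_of_pos_right hL]; linarith
  have h1' := Int.floor_le_floor h1
  have h2' := Int.floor_le_floor h2
  rw [Int.floor_add_one] at h1' h2'
  simp only [cellIndex]
  constructor <;> linarith

/-- Near any point the periodisation of a function vanishing off `Λ_{L₀}^N ⊆ [0,L)^{3N}` is a
FINITE sum of lattice translates. [folklore] -/
theorem periodize_eq_sum {L₀ L : ℝ} (hL : 0 < L) (hL₀ : L₀ ≤ L) {ψ : Config N → ℂ}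
    (h0 : ∀ X, X ∉ boxN N L₀ → ψ X = 0) {X X₀ : Config N} (h : ∀ i k, |X i k - X₀ i k| < L) :
    periodize L ψ X = ∑ n ∈ nearIndices (cellIndex L X₀), ψ (X - latticeVecN L n) := by
  rw [Finset.sum_eq_single_of_mem (cellIndex L X) (cellIndex_mem_nearIndices hL h)
    (fun n _ hn => apply_sub_latticeVecN_eq_zero hL hL₀ h0 hn)]
  rfl

/-- Coordinates of nearby configurations are nearby. [folklore] -/
theorem abs_sub_apply_lt_of_dist_lt {X X₀ : Config N} {r : ℝ} (h : dist X X₀ < r) (i : Fin N)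
    (k : Fin 3) : |X i k - X₀ i k| < r :=
  calc |X i k - X₀ i k| = ‖(X i - X₀ i) k‖ := by simp
    _ ≤ ‖X i - X₀ i‖ := PiLp.norm_apply_le (X i - X₀ i) k
    _ = dist (X i) (X₀ i) := (dist_eq_norm _ _).symm
    _ ≤ dist X X₀ := dist_le_pi_dist X X₀ i
    _ < r := h

/-- **The periodisation of a `C¹` function vanishing off `Λ_{L₀}^N ⊆ [0,L)^{3N}` is `C¹`**
(locally it is a finite sum of translates). [folklore] -/
theorem contDiff_periodize {L₀ L : ℝ} (hL : 0 < L) (hL₀ : L₀ ≤ L) {ψ : Config N → ℂ}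
    (hψ : ContDiff ℝ 1 ψ) (h0 : ∀ X, X ∉ boxN N L₀ → ψ X = 0) :
    ContDiff ℝ 1 (periodize L ψ) := by
  refine contDiff_iff_contDiffAt.2 fun X₀ => ?_
  have hsum : ContDiff ℝ 1 fun X : Config N =>
      ∑ n ∈ nearIndices (cellIndex L X₀), ψ (X - latticeVecN L n) :=
    ContDiff.sum fun n _ => hψ.comp (contDiff_id.sub contDiff_const)
  refine hsum.contDiffAt.congr_of_eventuallyEq ?_
  filter_upwards [Metric.ball_mem_nhds X₀ hL] with X hX
  exact periodize_eq_sum hL hL₀ h0 (abs_sub_apply_lt_of_dist_lt hX)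

/-- The open box `Λ_L^N` is open. [folklore] -/
theorem boxN_mem_nhds {L : ℝ} {X : Config N} (hX : X ∈ boxN N L) : boxN N L ∈ 𝓝 X := by
  have hopen : IsOpen (boxN N L) := by
    have : boxN N L = ⋂ i : Fin N, ⋂ k : Fin 3, (fun X : Config N => X i k) ⁻¹' Set.Ioo 0 L := by
      ext X; simp [boxN, box]
    rw [this]
    refine isOpen_iInter_of_finite fun i => isOpen_iInter_of_finite fun k => ?_
    exact isOpen_Ioo.preimage ((EuclideanSpace.proj k).continuous.comp (continuous_apply i))
  exact hopen.mem_nhds hX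

/-- On the open box `Λ_L^N ⊆ [0,L)^{3N}` the periodisation agrees with the function near every
point, hence has the same kinetic energy density. [folklore] -/
theorem kineticDensity_periodize_of_mem_boxN {L : ℝ} (hL : 0 < L) (ψ : Config N → ℂ)
    {X : Config N} (hX : X ∈ boxN N L) :
    kineticDensity (periodize L ψ) X = kineticDensity ψ X := by
  have h : periodize L ψ =ᶠ[𝓝 X] ψ := by
    filter_upwards [boxN_mem_nhds hX] with Y hY
    exact periodize_of_mem_cellN hL ψ (boxN_subset_cellN le_rfl hY)
  unfold kineticDensity
  rw [h.fderiv_eq]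

/-- **Nearest image.** For a potential of range `R₀` and a separation vector `y` with
`|y_k| < L - R₀` in every coordinate, only the `n = 0` term of the periodised potential survives:
`v^per_L(y) = v(|y|)`. [cite: LSSY2005, Thm. 2.2, proof ("taking the periodic boundary condition into account")] -/
theorem periodizedPotential_eq_of_abs_lt {v : ℝ → ℝ≥0∞} {R₀ L : ℝ} (hv : ∀ r, R₀ < r → v r = 0)
    (hL : 0 < L) {y : Space} (hy : ∀ k, |y k| < L - R₀) :
    periodizedPotential v L y = v ‖y‖ := by
  unfold periodizedPotential
  rw [tsum_eq_single 0]
  · simp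
  · intro n hn
    obtain ⟨k, hk⟩ : ∃ k, n k ≠ 0 := Function.ne_iff.mp hn
    apply hv
    rcases lt_or_ge R₀ 0 with hR | hR
    · exact hR.trans_le (norm_nonneg _)
    · have h1 : (1 : ℝ) ≤ |(n k : ℝ)| := by
        rw [← Int.cast_abs]; exact_mod_cast Int.one_le_abs hk
      have h2 := hy k
      have h3 : |L * n k| - |y k| ≤ |y k - L * n k| := by
        have := abs_sub_abs_le_abs_sub (L * n k) (y k)
        rwa [abs_sub_comm] at this
      have h4 : L ≤ |L * (n k : ℝ)| := by
        rw [abs_mul, abs_of_pos hL]; nlinarith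
      calc R₀ < |L * n k| - |y k| := by linarith
        _ ≤ |y k - L * n k| := h3
        _ = ‖(y - latticeVec L n) k‖ := by simp [latticeVec]
        _ ≤ ‖y - latticeVec L n‖ := PiLp.norm_apply_le (y - latticeVec L n) k

/-- **No image interactions.** On the box `Λ_{L₀}^N`, with `L₀ + R₀ ≤ L`, the interaction
periodised with period `L` is the plain interaction: particles of the box are farther than the
range `R₀` from all images of the others. [cite: LSSY2005, Thm. 2.2, proof] -/
theorem periodicInteraction_eq_interaction_of_mem_boxN {v : ℝ → ℝ≥0∞} {R₀ L₀ L : ℝ}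
    (hv : ∀ r, R₀ < r → v r = 0) (hL : 0 < L) (hR : L₀ + R₀ ≤ L) {X : Config N}
    (hX : X ∈ boxN N L₀) : periodicInteraction v L X = interaction v X := by
  unfold periodicInteraction interaction
  refine Finset.sum_congr rfl fun i _ => Finset.sum_congr rfl fun j _ => ?_
  rw [dist_eq_norm]
  refine periodizedPotential_eq_of_abs_lt hv hL fun k => ?_
  have hi := hX i k
  have hj := hX j k
  simp only [Set.mem_Ioo] at hi hj
  have : |(X i - X j) k| < L₀ := by
    simp only [PiLp.sub_apply]
    rw [abs_lt]
    constructor <;> linarith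
  linarith

/-- The **periodisation of a Dirichlet trial state** of `Λ_{L₀}` as a periodic trial state on the
torus of side `L ≥ L₀`: `C¹`, `(Lℤ³)^N`-periodic, Bose-symmetric and normalised on the cell (where
it coincides with the Dirichlet state). [cite: LSSY2005, Ch. 2, after (2.2)] -/
def TrialState.toPeriodic {L₀ L : ℝ} (Ψ : TrialState N L₀) (hL : 0 < L) (hL₀ : L₀ ≤ L) :
    PeriodicTrialState N L where
  ψ := periodize L Ψ.ψ
  contDiff := contDiff_periodize hL hL₀ Ψ.contDiff Ψ.eq_zero
  periodic X i k := by
    rw [single_single_eq_latticeVecN, periodize_add_latticeVecN hL.ne']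
  symm σ X := periodize_comp_perm Ψ.ψ σ (Ψ.symm σ) X
  norm_eq := by
    rw [← setLIntegral_congr (boxN_ae_eq_cellN N L),
      setLIntegral_congr_fun (measurableSet_boxN N L) (fun X hX => by
        rw [periodize_of_mem_cellN hL Ψ.ψ (boxN_subset_cellN le_rfl hX)]),
      setLIntegral_eq_of_support_subset]
    · exact Ψ.norm_eq
    · intro X hX
      by_contra h
      exact hX (by simp [Ψ.eq_zero X fun h' => h (boxN_subset_boxN hL₀ h')])

/-- **The periodic energy of the periodised state is at most the Dirichlet energy**, as soon as
`L ≥ L₀ + R₀` (no image interactions on the support). [cite: LSSY2005, Ch. 2, after (2.2) and Thm. 2.2] -/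
theorem TrialState.periodicEnergy_toPeriodic_le {v : ℝ → ℝ≥0∞} {R₀ L₀ L : ℝ} (Ψ : TrialState N L₀)
    (hv : ∀ r, R₀ < r → v r = 0) (hL : 0 < L) (hL₀ : L₀ ≤ L) (hR : L₀ + R₀ ≤ L) :
    periodicEnergy v (Ψ.toPeriodic hL hL₀) ≤ energy v Ψ := by
  unfold periodicEnergy energy
  have hpt : ∀ X, periodicInteraction v L X * (‖Ψ.ψ X‖₊ : ℝ≥0∞) ^ 2 =
      interaction v X * (‖Ψ.ψ X‖₊ : ℝ≥0∞) ^ 2 := by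
    intro X
    by_cases hX : X ∈ boxN N L₀
    · rw [periodicInteraction_eq_interaction_of_mem_boxN hv hL hR hX]
    · simp [Ψ.eq_zero X hX]
  calc ∫⁻ X in cellN N L, kineticDensity (Ψ.toPeriodic hL hL₀).ψ X +
        periodicInteraction v L X * (‖(Ψ.toPeriodic hL hL₀).ψ X‖₊ : ℝ≥0∞) ^ 2
      = ∫⁻ X in boxN N L, kineticDensity (periodize L Ψ.ψ) X +
        periodicInteraction v L X * (‖periodize L Ψ.ψ X‖₊ : ℝ≥0∞) ^ 2 :=
        (setLIntegral_congr (boxN_ae_eq_cellN N L)).symm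
    _ = ∫⁻ X in boxN N L, kineticDensity Ψ.ψ X + interaction v X * (‖Ψ.ψ X‖₊ : ℝ≥0∞) ^ 2 := by
        refine setLIntegral_congr_fun (measurableSet_boxN N L) fun X hX => ?_
        rw [kineticDensity_periodize_of_mem_boxN hL Ψ.ψ hX,
          periodize_of_mem_cellN hL Ψ.ψ (boxN_subset_cellN le_rfl hX), hpt X]
    _ ≤ _ := setLIntegral_le_lintegral _ _

/-- **Periodic ≤ Dirichlet up to the range.** For a potential of range `R₀`, the periodic
ground-state energy on the torus of side `L` is at most the Dirichlet ground-state energy in any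
box `Λ_{L₀}` with `L₀ ≤ L` and `L₀ + R₀ ≤ L`: `E₀^per(N, L) ≤ E₀^D(N, L₀)` (periodise the Dirichlet
trial states; the padding `R₀` kills the image interactions). This is the finite-volume content
of "Dirichlet boundary conditions lead to the highest energies" for the periodised interaction.
[cite: LSSY2005, Ch. 2, after (2.2); Thm. 2.2 ("and for all boundary conditions")] -/
theorem periodicGroundStateEnergy_le_groundStateEnergy_of_range {v : ℝ → ℝ≥0∞} {R₀ L₀ L : ℝ}
    (hv : ∀ r, R₀ < r → v r = 0) (hL : 0 < L) (hL₀ : L₀ ≤ L) (hR : L₀ + R₀ ≤ L) (N : ℕ) :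
    periodicGroundStateEnergy v N L ≤ groundStateEnergy v N L₀ :=
  le_iInf fun Ψ => (periodicGroundStateEnergy_le v (Ψ.toPeriodic hL hL₀)).trans
    (Ψ.periodicEnergy_toPeriodic_le hv hL hL₀ hR)

/-- The same for the standing class: a repulsive finite-range potential admits a padding `R ≥ 0`
with `E₀^per(N, L₀ + R') ≤ E₀^D(N, L₀)` for all `R' ≥ R` and all boxes `L₀ > 0`. [cite: LSSY2005, Ch. 2, after (2.2)] -/
theorem IsRepulsiveFiniteRange.exists_periodicGroundStateEnergy_le {v : ℝ → ℝ≥0∞}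
    (hv : IsRepulsiveFiniteRange v) :
    ∃ R : ℝ, 0 ≤ R ∧ ∀ (N : ℕ) (L₀ R' : ℝ), 0 < L₀ → R ≤ R' →
      periodicGroundStateEnergy v N (L₀ + R') ≤ groundStateEnergy v N L₀ := by
  obtain ⟨R₀, hR₀⟩ := hv.2
  refine ⟨max R₀ 0, le_max_right _ _, fun N L₀ R' hL₀ hR' => ?_⟩
  have h0 : 0 ≤ R' := (le_max_right R₀ 0).trans hR'
  exact periodicGroundStateEnergy_le_groundStateEnergy_of_range hR₀ (by linarith) (by linarith)
    (by linarith [le_max_left R₀ 0]) N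

/-! ### Consequences along the fixed-density box sequence -/

/-- The side `L_N(ρ) = (N/ρ)^{1/3}` decreases with the density. [folklore] -/
theorem sideLength_le_sideLength {ρ ρ' : ℝ} (hρ : 0 < ρ) (h : ρ ≤ ρ') (N : ℕ) :
    sideLength ρ' N ≤ sideLength ρ N := by
  unfold sideLength
  refine Real.rpow_le_rpow (div_nonneg N.cast_nonneg (hρ.le.trans h)) ?_ (by norm_num)
  exact div_le_div_of_nonneg_left N.cast_nonneg hρ h

/-- `L_N(ρ) = N^{1/3} ρ^{-1/3}`. [folklore] -/
theorem sideLength_eq_rpow_mul {ρ : ℝ} (hρ : 0 < ρ) (N : ℕ) :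
    sideLength ρ N = (N : ℝ) ^ (1 / 3 : ℝ) * (ρ ^ (1 / 3 : ℝ))⁻¹ := by
  rw [sideLength, Real.div_rpow N.cast_nonneg hρ.le, div_eq_mul_inv]

/-- **The Dirichlet energy per particle increases with the density at fixed `N`** (the box
shrinks): `E₀^D(N, L_N(ρ))/N ≤ E₀^D(N, L_N(ρ'))/N` for `0 < ρ ≤ ρ'`. [folklore] -/
theorem energyPerParticleDirichlet_mono (v : ℝ → ℝ≥0∞) {ρ ρ' : ℝ} (hρ : 0 < ρ) (h : ρ ≤ ρ')
    (N : ℕ) : energyPerParticleDirichlet v ρ N ≤ energyPerParticleDirichlet v ρ' N := by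
  unfold energyPerParticleDirichlet
  gcongr
  exact groundStateEnergy_anti v N (sideLength_le_sideLength hρ h N)

/-- At two fixed densities `ρ' < ρ` the boxes `L_N(ρ') > L_N(ρ)` drift apart:
`L_N(ρ') - L_N(ρ) = N^{1/3}(ρ'^{-1/3} - ρ^{-1/3}) → ∞`. [folklore] -/
theorem tendsto_sideLength_sub_sideLength {ρ ρ' : ℝ} (hρ' : 0 < ρ') (h : ρ' < ρ) :
    Tendsto (fun N : ℕ => sideLength ρ' N - sideLength ρ N) atTop atTop := by
  have hρ : 0 < ρ := hρ'.trans h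
  have hc : 0 < (ρ' ^ (1 / 3 : ℝ))⁻¹ - (ρ ^ (1 / 3 : ℝ))⁻¹ := by
    rw [sub_pos]
    exact inv_strictAnti₀ (Real.rpow_pos_of_pos hρ' _) (Real.rpow_lt_rpow hρ'.le h (by norm_num))
  have he : (fun N : ℕ => sideLength ρ' N - sideLength ρ N) =
      fun N : ℕ => (N : ℝ) ^ (1 / 3 : ℝ) * ((ρ' ^ (1 / 3 : ℝ))⁻¹ - (ρ ^ (1 / 3 : ℝ))⁻¹) := by
    funext N
    rw [sideLength_eq_rpow_mul hρ', sideLength_eq_rpow_mul hρ, mul_sub]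
  rw [he]
  exact ((tendsto_rpow_atTop (by norm_num)).comp tendsto_natCast_atTop_atTop).atTop_mul_const hc

/-- **Periodic at lower density ≤ Dirichlet at higher density, eventually.** For a repulsive
finite-range potential and densities `0 < ρ' < ρ`, along the box sequences
`E₀^per(N, L_N(ρ'))/N ≤ E₀^D(N, L_N(ρ))/N` for all large `N` (as soon as
`L_N(ρ') ≥ L_N(ρ) + R₀`). This is the variational half of the boundary-condition independence of
`e₀(ρ)` between periodic and Dirichlet conditions, up to the density shift forced by the padding.
[cite: LSSY2005, Ch. 2, after (2.2); Thm. 2.2 ("and for all boundary conditions")] -/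
theorem IsRepulsiveFiniteRange.eventually_energyPerParticlePeriodic_le {v : ℝ → ℝ≥0∞}
    (hv : IsRepulsiveFiniteRange v) {ρ ρ' : ℝ} (hρ' : 0 < ρ') (h : ρ' < ρ) :
    ∀ᶠ N : ℕ in atTop, energyPerParticlePeriodic v ρ' N ≤ energyPerParticleDirichlet v ρ N := by
  obtain ⟨R, hR0, hR⟩ := hv.exists_periodicGroundStateEnergy_le
  have hρ : 0 < ρ := hρ'.trans h
  filter_upwards [(tendsto_sideLength_sub_sideLength hρ' h).eventually_ge_atTop R,
    eventually_gt_atTop 0] with N hN hN0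
  unfold energyPerParticlePeriodic energyPerParticleDirichlet
  gcongr
  have hL₀ : 0 < sideLength ρ N := by
    unfold sideLength
    exact Real.rpow_pos_of_pos (div_pos (Nat.cast_pos.2 hN0) hρ) _
  have := hR N (sideLength ρ N) (sideLength ρ' N - sideLength ρ N) hL₀ hN
  rwa [add_sub_cancel] at this

end Literature.MathematicalPhysics.QuantumManyBody.BoseGas

end
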